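import Summits.Ventures.PercRepro.C026GoodDegreeForms

/-!
# A (CC)-flow closes THEOREM L2 (p6, gen 20)

mine-3's certificate system (CC) for ROW C-041 (MINE3-GLUING §42) is a flow: every Bad `(D,A)` source
sends `2` units to Good sources (inside its cluster cube), every `GG` source receives at most `4`, every
`SG` source at most `1`.  The count behind it needs only the capacities, not the cube structure:
by double counting, any function `f : Bad × Good → ℕ` with row sums `≥ 2` and column sums within the
capacities gives `2·#Bad ≤ 4·#GG + #SG` (`card_bad_le_of_flow`), which is `(G⅔)`
(`goodDegree_iff_bad_le_GG_SG`) and hence THEOREM L2 (`pFun_threeCells_nonneg_of_flow`).  So the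
kernel side of (CC) is now: the principal cluster-cube theorem (`C026ClusterCube`, the per-source
case) plus this bridge; what remains is the Hall condition across cubes (a flow exists).
-/

namespace PercRepro

namespace MultiGraph

open Finset

variable {V E : Type*} {G : MultiGraph V E} [Fintype V] [DecidableEq V] [Fintype E] [DecidableEq E]

omit [Fintype V] [DecidableEq V] in
open Classical in
/-- **Double counting a (CC)-flow**: if every Bad source sends at least `2` units to the Good sources,
every `GG` source receives at most `4` and every `SG` source at most `1`, then `2·#Bad ≤ 4·#GG + #SG`. -/
theorem card_bad_le_of_flow (a b c : V) (f : Config E → Config E → ℕ)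
    (hsrc : ∀ S ∈ (univ.filter fun S : Config E => ((G.Conn S c a ∧ G.Conn S c b) ∧
          (¬ G.Conn Sᶜ c a ∧ ¬ G.Conn Sᶜ c b ∧ ¬ G.Conn Sᶜ a b)) ∧
          ¬ (G.WalkAvoiding S (G.cluster Sᶜ a) c b ∨ G.WalkAvoiding S (G.cluster Sᶜ b) c a)),
        2 ≤ ∑ T ∈ (univ.filter fun T : Config E => ((G.Conn T c a ∧ G.Conn T c b) ∧
          (¬ G.Conn Tᶜ c a ∧ ¬ G.Conn Tᶜ c b ∧ ¬ G.Conn Tᶜ a b)) ∧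
          (G.WalkAvoiding T (G.cluster Tᶜ a) c b ∨ G.WalkAvoiding T (G.cluster Tᶜ b) c a)), f S T)
    (hcap : ∀ T ∈ (univ.filter fun T : Config E => ((G.Conn T c a ∧ G.Conn T c b) ∧
          (¬ G.Conn Tᶜ c a ∧ ¬ G.Conn Tᶜ c b ∧ ¬ G.Conn Tᶜ a b)) ∧
          (G.WalkAvoiding T (G.cluster Tᶜ a) c b ∨ G.WalkAvoiding T (G.cluster Tᶜ b) c a)),
        ∑ S ∈ (univ.filter fun S : Config E => ((G.Conn S c a ∧ G.Conn S c b) ∧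
          (¬ G.Conn Sᶜ c a ∧ ¬ G.Conn Sᶜ c b ∧ ¬ G.Conn Sᶜ a b)) ∧
          ¬ (G.WalkAvoiding S (G.cluster Sᶜ a) c b ∨ G.WalkAvoiding S (G.cluster Sᶜ b) c a)), f S T ≤
        if G.WalkAvoiding T (G.cluster Tᶜ a) c b ∧ G.WalkAvoiding T (G.cluster Tᶜ b) c a then 4
        else 1) :
    2 * (univ.filter fun S : Config E => ((G.Conn S c a ∧ G.Conn S c b) ∧
          (¬ G.Conn Sᶜ c a ∧ ¬ G.Conn Sᶜ c b ∧ ¬ G.Conn Sᶜ a b)) ∧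
          ¬ (G.WalkAvoiding S (G.cluster Sᶜ a) c b ∨
            G.WalkAvoiding S (G.cluster Sᶜ b) c a)).card ≤
      4 * (univ.filter fun S : Config E => ((G.Conn S c a ∧ G.Conn S c b) ∧
          (¬ G.Conn Sᶜ c a ∧ ¬ G.Conn Sᶜ c b ∧ ¬ G.Conn Sᶜ a b)) ∧
          (G.WalkAvoiding S (G.cluster Sᶜ a) c b ∧ G.WalkAvoiding S (G.cluster Sᶜ b) c a)).card +
        (univ.filter fun S : Config E => ((G.Conn S c a ∧ G.Conn S c b) ∧
          (¬ G.Conn Sᶜ c a ∧ ¬ G.Conn Sᶜ c b ∧ ¬ G.Conn Sᶜ a b)) ∧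
          ((G.WalkAvoiding S (G.cluster Sᶜ a) c b ∧ ¬ G.WalkAvoiding S (G.cluster Sᶜ b) c a) ∨
            (G.WalkAvoiding S (G.cluster Sᶜ b) c a ∧
              ¬ G.WalkAvoiding S (G.cluster Sᶜ a) c b))).card := by
  set Bad := univ.filter fun S : Config E => ((G.Conn S c a ∧ G.Conn S c b) ∧
    (¬ G.Conn Sᶜ c a ∧ ¬ G.Conn Sᶜ c b ∧ ¬ G.Conn Sᶜ a b)) ∧
    ¬ (G.WalkAvoiding S (G.cluster Sᶜ a) c b ∨ G.WalkAvoiding S (G.cluster Sᶜ b) c a) with hBad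
  set Good := univ.filter fun T : Config E => ((G.Conn T c a ∧ G.Conn T c b) ∧
    (¬ G.Conn Tᶜ c a ∧ ¬ G.Conn Tᶜ c b ∧ ¬ G.Conn Tᶜ a b)) ∧
    (G.WalkAvoiding T (G.cluster Tᶜ a) c b ∨ G.WalkAvoiding T (G.cluster Tᶜ b) c a) with hGood
  -- the total flow, counted from the sources and from the targets
  have h1 : 2 * Bad.card ≤ ∑ S ∈ Bad, ∑ T ∈ Good, f S T := by
    rw [mul_comm, ← smul_eq_mul, ← Finset.sum_const]
    exact Finset.sum_le_sum hsrc
  have h2 : ∑ S ∈ Bad, ∑ T ∈ Good, f S T = ∑ T ∈ Good, ∑ S ∈ Bad, f S T := Finset.sum_comm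
  have h3 : ∑ T ∈ Good, ∑ S ∈ Bad, f S T ≤ ∑ T ∈ Good,
      (if G.WalkAvoiding T (G.cluster Tᶜ a) c b ∧ G.WalkAvoiding T (G.cluster Tᶜ b) c a then 4
        else 1) :=
    Finset.sum_le_sum hcap
  -- the capacity total is `4·#GG + #SG`
  have h4 : ∑ T ∈ Good,
      (if G.WalkAvoiding T (G.cluster Tᶜ a) c b ∧ G.WalkAvoiding T (G.cluster Tᶜ b) c a then 4
        else 1) =
      4 * (Good.filter fun T : Config E => G.WalkAvoiding T (G.cluster Tᶜ a) c b ∧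
          G.WalkAvoiding T (G.cluster Tᶜ b) c a).card +
        (Good.filter fun T : Config E => ¬ (G.WalkAvoiding T (G.cluster Tᶜ a) c b ∧
          G.WalkAvoiding T (G.cluster Tᶜ b) c a)).card := by
    rw [Finset.sum_ite, Finset.sum_const, Finset.sum_const, smul_eq_mul, smul_eq_mul, mul_one,
      mul_comm]
  have h5 : (Good.filter fun T : Config E => G.WalkAvoiding T (G.cluster Tᶜ a) c b ∧
      G.WalkAvoiding T (G.cluster Tᶜ b) c a) =
      univ.filter fun S : Config E => ((G.Conn S c a ∧ G.Conn S c b) ∧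
        (¬ G.Conn Sᶜ c a ∧ ¬ G.Conn Sᶜ c b ∧ ¬ G.Conn Sᶜ a b)) ∧
        (G.WalkAvoiding S (G.cluster Sᶜ a) c b ∧ G.WalkAvoiding S (G.cluster Sᶜ b) c a) := by
    rw [hGood, Finset.filter_filter]
    apply Finset.filter_congr
    intro T _
    constructor
    · rintro ⟨⟨hDA, _⟩, hGG⟩
      exact ⟨hDA, hGG⟩
    · rintro ⟨hDA, hGG⟩
      exact ⟨⟨hDA, Or.inl hGG.1⟩, hGG⟩
  have h6 : (Good.filter fun T : Config E => ¬ (G.WalkAvoiding T (G.cluster Tᶜ a) c b ∧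
      G.WalkAvoiding T (G.cluster Tᶜ b) c a)) =
      univ.filter fun S : Config E => ((G.Conn S c a ∧ G.Conn S c b) ∧
        (¬ G.Conn Sᶜ c a ∧ ¬ G.Conn Sᶜ c b ∧ ¬ G.Conn Sᶜ a b)) ∧
        ((G.WalkAvoiding S (G.cluster Sᶜ a) c b ∧ ¬ G.WalkAvoiding S (G.cluster Sᶜ b) c a) ∨
          (G.WalkAvoiding S (G.cluster Sᶜ b) c a ∧ ¬ G.WalkAvoiding S (G.cluster Sᶜ a) c b)) := by
    rw [hGood, Finset.filter_filter]
    apply Finset.filter_congr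
    intro T _
    constructor
    · rintro ⟨⟨hDA, hor⟩, hnot⟩
      refine ⟨hDA, ?_⟩
      rcases hor with h | h
      · exact Or.inl ⟨h, fun h' => hnot ⟨h, h'⟩⟩
      · exact Or.inr ⟨h, fun h' => hnot ⟨h', h⟩⟩
    · rintro ⟨hDA, hor⟩
      rcases hor with ⟨h, h'⟩ | ⟨h, h'⟩
      · exact ⟨⟨hDA, Or.inl h⟩, fun hGG => h' hGG.2⟩
      · exact ⟨⟨hDA, Or.inr h⟩, fun hGG => h' hGG.1⟩
  rw [h5, h6] at h4
  omega

open Classical in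
/-- **A (CC)-flow closes THEOREM L2 (live probe)**: a function `f` sending at least `2` units from
every Bad source to the Good sources, with at most `4` units arriving at a `GG` source and at most
`1` at an `SG` source, gives `(P) ≥ 0` at every band state of the probe and the two live vertices. -/
theorem pFun_threeCells_nonneg_of_flow (a b c : V) (f : Config E → Config E → ℕ)
    (hsrc : ∀ S ∈ (univ.filter fun S : Config E => ((G.Conn S c a ∧ G.Conn S c b) ∧
          (¬ G.Conn Sᶜ c a ∧ ¬ G.Conn Sᶜ c b ∧ ¬ G.Conn Sᶜ a b)) ∧
          ¬ (G.WalkAvoiding S (G.cluster Sᶜ a) c b ∨ G.WalkAvoiding S (G.cluster Sᶜ b) c a)),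
        2 ≤ ∑ T ∈ (univ.filter fun T : Config E => ((G.Conn T c a ∧ G.Conn T c b) ∧
          (¬ G.Conn Tᶜ c a ∧ ¬ G.Conn Tᶜ c b ∧ ¬ G.Conn Tᶜ a b)) ∧
          (G.WalkAvoiding T (G.cluster Tᶜ a) c b ∨ G.WalkAvoiding T (G.cluster Tᶜ b) c a)), f S T)
    (hcap : ∀ T ∈ (univ.filter fun T : Config E => ((G.Conn T c a ∧ G.Conn T c b) ∧
          (¬ G.Conn Tᶜ c a ∧ ¬ G.Conn Tᶜ c b ∧ ¬ G.Conn Tᶜ a b)) ∧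
          (G.WalkAvoiding T (G.cluster Tᶜ a) c b ∨ G.WalkAvoiding T (G.cluster Tᶜ b) c a)),
        ∑ S ∈ (univ.filter fun S : Config E => ((G.Conn S c a ∧ G.Conn S c b) ∧
          (¬ G.Conn Sᶜ c a ∧ ¬ G.Conn Sᶜ c b ∧ ¬ G.Conn Sᶜ a b)) ∧
          ¬ (G.WalkAvoiding S (G.cluster Sᶜ a) c b ∨ G.WalkAvoiding S (G.cluster Sᶜ b) c a)), f S T ≤
        if G.WalkAvoiding T (G.cluster Tᶜ a) c b ∧ G.WalkAvoiding T (G.cluster Tᶜ b) c a then 4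
        else 1)
    {z κ x₁ K₁ x₂ K₂ : ℝ}
    (hz : 0 ≤ z ∧ z ≤ 1) (hκ : kMin z ≤ κ) (hx₁ : 0 ≤ x₁ ∧ x₁ ≤ 1) (hx₂ : 0 ≤ x₂ ∧ x₂ ≤ 1)
    (hK₁ : kMin x₁ ≤ K₁) (hK₂ : kMin x₂ ≤ K₂) :
    0 ≤ G.pFun c (threeCells c a b z x₁ x₂) (threeCells c a b κ K₁ K₂) univ :=
  pFun_threeCells_nonneg_of_bad_le_GG_SG a b c (card_bad_le_of_flow a b c f hsrc hcap)
    hz hκ hx₁ hx₂ hK₁ hK₂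

end MultiGraph

end PercRepro
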